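import Mathlib
import HarnessLib
import HarnessLib.Audit

/-!
# Sahi (2008): the higher correlation functionals `E_n` and the `n`-function FKG conjecture

CITATION HEADER.  Sources: S. Sahi, *Higher correlation inequalities*, Combinatorica **28** (2008)
209–227 [Sahi2008]; E. H. Lieb, S. Sahi, *On the extension of the FKG inequality to `n` functions*,
J. Math. Phys. **63** (2022) 043301 = arXiv:2107.09838 [LiebSahi2021] (read 2026-08-19 from the
materialised arXiv text, corpus `paper:arxiv-2107.09838`); V. Blinovsky, arXiv:1306.0862 [Blinovsky2013]
(restates Sahi's definition, corpus `paper:arxiv-1306.0862` p. 1).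

## What is reproduced (typed skeleton; everything stated here is PROVED except the tagged conjecture)

* The setting ("FKG poset", [LiebSahi2021, §1]): a finite distributive lattice `α` with a probability
  weight `μ : α → ℝ`, `μ ≥ 0`, `∑ μ = 1`, satisfying the lattice condition
  `μ(a)μ(b) ≤ μ(a ⊓ b)μ(a ⊔ b)` — `IsFKGMeasure μ`; expectation `ex μ f = ∑ x, μ x * f x`.
  (Sahi 2008 works on `2^X`, `X` finite [Sahi2008, p. 210, eq. (8) p. 212]; Lieb–Sahi state everything for
  FKG posets.  Mathlib's `fkg` (file `Mathlib/Combinatorics/SetFamily/FourFunctions.lean`) is stated in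
  exactly this weight form.)
* Sahi's multilinear functionals `E_n(f_1,…,f_n)` — `sahiE μ n f` for a family `f : Fin n → (α → ℝ)`.
  DESIGN CHOICE (read this): Sahi defines `E_n = Σ_{λ ⊢ n} c_λ E_λ`, `c_λ = (−1)^{ℓ(λ)−1} Π (λ_i − 1)!`,
  `E_λ` = the sum over set partitions of type `λ` of the products of joint moments [Sahi2008, eqs. (4)–(7)
  (p. 211); Blinovsky2013, p. 1], equivalently the cycle sum `E_n = Σ_{σ ∈ S_n} (−1)^{C_σ−1} E_σ`
  [LiebSahi2021, Def. 3.1].  Lieb–Sahi prove the RECURSION [LiebSahi2021, Prop. 3.3]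
  `E_n(f^1,…,f^{n−1},f) = e_1 + ⋯ + e_{n−1} − e_n`, `e_i = E_{n−1}(f^1,…,f^i f,…,f^{n−1})` (`i < n`),
  `e_n = E_{n−1}(f^1,…,f^{n−1})·E(f)`, which together with `E_1 = E` determines every `E_n` uniquely.  We take
  this recursion as the Lean DEFINITION (peeling the distinguished function from slot `0` rather than from
  the last slot — immaterial by the symmetry of `E_n`, proved in `Sahi2008/Symmetry.lean`), and we VERIFY the
  printed closed forms: `E_1 = E(f)`, `E_2 = E(fg) − E(f)E(g)` [LiebSahi2021, (1.1)],
  `E_3 = 2E(fgh) − E(f)E(gh) − E(g)E(fh) − E(h)E(fg) + E(f)E(g)E(h)` [Sahi2008, p. 213 "E₃ = 2E_(3) − E_(2,1)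
  + E_(1,1,1)"; LiebSahi2021, (2.1)], and the fifteen-term `E_4` [LiebSahi2021, display after Def. 3.1]
  (`sahiE_one`, `sahiE_two`, `sahiE_three`, `sahiE_four`).  `E_0 := 0` is a junk value (never used by the
  recursion, which starts at `E_1`).
  GENERAL FORM (formerly a TODO here, now DISCHARGED): the set-partition presentation of `E_n` for general
  `n` [Sahi2008, (4)–(7)] is `sahiE_eq_sahiESetPartition` (`Sahi2008/SetPartitionForm.lean`, over Mathlib's
  `OrderedFinpartition`), and the cycle-sum presentation [LiebSahi2021, Def. 3.1] with its block expansion is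
  `CycleForm.cycleSum` / `sahiE_eq_sum_blocks` (`Sahi2008/CycleForm.lean`, `Sahi2008/FixedCycle.lean`).
* The BRANCHING identity [Sahi2008, Thm. 6 (p. 214); LiebSahi2021, (1.3)]
  `E_n(f_1,…,f_{n−1},1) = (n − 2)·E_{n−1}(f_1,…,f_{n−1})` — here with the constant function in slot `0`:
  `sahiE_succ_succ_of_head_eq_one`, `sahiE_one_cons`; and `E_n(1,…,1) = 0` for `n ≥ 2` (`sahiE_const_one`).
* The PROPERTY "Sahi positivity of order `n`" of a weight `μ`: `E_n(f) ≥ 0` for all nonnegative monotone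
  `n`-families — `SahiPositive μ n` (a predicate, used as a hypothesis; `n = 2` is positive association /
  FKG).  Sahi's assertion that EVERY FKG poset has it for every `n` [Sahi2008, Conj. 5 (p. 212); LiebSahi2021,
  Conj. 1.1] is NOT stated in `Literature/`: by the tree's rules it is an obligation of our theories, filed as
  `Summits/CriticalPhenomena/PercolationContinuityZ3/Theorems/SahiConjecture.lean` (`@[conjecture]`), which
  quantifies this predicate over all finite distributive lattices and FKG probability weights.
* The HIERARCHY [LiebSahi2021, p. 3: "if `C_n` denotes the `n`-function positivity conjecture, then `C_n`
  implies `C_{n−1}` for `n > 2`"], per weight: `SahiPositive.of_succ`, `SahiPositive.anti`; orders `0`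
  (vacuous) and `1` (`E_1 = E(f) ≥ 0`) are proved here, order `2` = FKG in `Sahi2008/FKG.lean` from Mathlib's
  `fkg`.

## Status of Sahi's question in print (2026-08-19)

Unresolved for every `n ≥ 3`, even for product measures on `{0,1}^k` and indicator functions of three up-sets
[Kahn2022, Conj. 5 and p. 3: "has to date proved thoroughly intractable"]; [LiebSahi2021, p. 3]: "beyond the
special cases treated in [Sahi2008], Conjecture 1.1 remains a conjecture, even for `n = 3, 4, 5`" (Richards'
announced proofs "have essential gaps"); freshest printed status by Sahi himself: [DubeySahi2025, footnote 6]
("the general problem remains open").  PROVED special classes in print: Sahi's cumulations `𝒞[X]` under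
product measures, all `n` [Sahi2008, Thm. 2] (FKG measures: [Blinovsky2013]); `|X| ≤ 2` [Sahi2008, Prop. 15];
Lebesgue measure on `[0,1]²` and rectangles in `[0,1]^k` [LiebSahi2021, Thms. 2.1, 3.5].  The tree proves the
`n = 3` principal-up-set case (`Literature.Probability.LatticeModels.latticeE3_nonneg_of_principal`).
NOTHING in this file asserts Sahi's Conjecture 5; only proved statements and the predicate appear.

## Not here

Multilinearity in each slot and symmetry under permutations (`Sahi2008/Symmetry.lean`); the identification
of order-`2` positivity with FKG (`Sahi2008/FKG.lean`); the specialisation to product Bernoulli measures / percolation events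
(`Sahi2008/Percolation.lean`); the generating-function form [Sahi2008, Conj. 4; LiebSahi2021, Conj. 1.2].
-/

namespace Literature.Combinatorics.Sahi2008

open Finset

variable {α : Type*} [Fintype α]

/-! ### Expectation under a weight -/

/-- The expectation `E(f) = ∑_x μ(x) f(x)` of `f` under the weight `μ` (a probability weight in the
applications; Mathlib's `fkg` is stated with these sums). [cite: LiebSahi2021, eq. (1.1)] -/
def ex (μ : α → ℝ) (f : α → ℝ) : ℝ := ∑ x, μ x * f x

/-- Unfolding `ex`. [cite: LiebSahi2021, eq. (1.1)] -/
theorem ex_def (μ f : α → ℝ) : ex μ f = ∑ x, μ x * f x := rfl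

/-- `E` is additive. [folklore] -/
theorem ex_add (μ f g : α → ℝ) : ex μ (f + g) = ex μ f + ex μ g := by
  simp only [ex, Pi.add_apply, mul_add, sum_add_distrib]

/-- `E` is homogeneous. [folklore] -/
theorem ex_smul (μ : α → ℝ) (c : ℝ) (f : α → ℝ) : ex μ (c • f) = c * ex μ f := by
  simp only [ex, Pi.smul_apply, smul_eq_mul, mul_sum]
  exact sum_congr rfl fun x _ => by ring

/-- `E` of a constant under a probability weight. [folklore] -/
theorem ex_const {μ : α → ℝ} (hμ : ∑ x, μ x = 1) (c : ℝ) : ex μ (fun _ => c) = c := by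
  rw [ex, ← sum_mul, hμ, one_mul]

/-- `E(1) = 1` under a probability weight. [folklore] -/
theorem ex_one {μ : α → ℝ} (hμ : ∑ x, μ x = 1) : ex μ 1 = 1 := ex_const hμ 1

/-- `E(f) ≥ 0` for `f ≥ 0` under a nonnegative weight. [cite: LiebSahi2021, eq. (1.2)] -/
theorem ex_nonneg {μ f : α → ℝ} (hμ : ∀ x, 0 ≤ μ x) (hf : ∀ x, 0 ≤ f x) : 0 ≤ ex μ f :=
  sum_nonneg fun x _ => mul_nonneg (hμ x) (hf x)

/-- `E` is monotone under a nonnegative weight. [folklore] -/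
theorem ex_mono {μ f g : α → ℝ} (hμ : ∀ x, 0 ≤ μ x) (hfg : ∀ x, f x ≤ g x) : ex μ f ≤ ex μ g :=
  sum_le_sum fun x _ => mul_le_mul_of_nonneg_left (hfg x) (hμ x)

/-! ### FKG posets -/

/-- **FKG probability weight** ("FKG poset" of Lieb–Sahi): a nonnegative weight of total mass `1` on a
finite lattice satisfying the lattice condition `μ(a)μ(b) ≤ μ(a ⊓ b)μ(a ⊔ b)` (Sahi's (8):
`μ(S ∪ T)μ(S ∩ T) ≥ μ(S)μ(T)` on `2^X`). [cite: LiebSahi2021, §1 (sup-mod); Sahi2008, eq. (8) (p. 212)] -/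
structure IsFKGMeasure [Lattice α] (μ : α → ℝ) : Prop where
  /-- pointwise nonnegative -/
  nonneg : ∀ x, 0 ≤ μ x
  /-- total mass one -/
  sum_eq_one : ∑ x, μ x = 1
  /-- the FKG lattice condition (log-supermodularity) -/
  mul_le_mul : ∀ a b, μ a * μ b ≤ μ (a ⊓ b) * μ (a ⊔ b)

/-! ### The functionals `E_n` -/

/-- **Sahi's higher correlation functional `E_n(f_0,…,f_{n−1})`** under the weight `μ`, defined by the
Lieb–Sahi recursion with the distinguished function in slot `0`:
`E_{n+2}(f_0, g_0,…,g_n) = Σ_{i ≤ n} E_{n+1}(g_0,…,g_i·f_0,…,g_n) − E_{n+1}(g_0,…,g_n)·E(f_0)`,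
`E_1(f) = E(f)` (and the junk value `E_0 := 0`).  Closed forms `n ≤ 4` below agree with the printed ones.
[cite: LiebSahi2021, Def. 3.1 and Prop. 3.3; Sahi2008, eqs. (4)–(7) (p. 211)] -/
def sahiE (μ : α → ℝ) : (n : ℕ) → (Fin n → α → ℝ) → ℝ
  | 0, _ => 0
  | 1, f => ex μ (f 0)
  | n + 2, f =>
      (∑ i : Fin (n + 1), sahiE μ (n + 1) (Function.update (Fin.tail f) i (Fin.tail f i * f 0))) -
        sahiE μ (n + 1) (Fin.tail f) * ex μ (f 0)

/-- The junk value `E_0 = 0`. [folklore] -/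
theorem sahiE_zero (μ : α → ℝ) (f : Fin 0 → α → ℝ) : sahiE μ 0 f = 0 := rfl

/-- `E_1(f) = E(f)`. [cite: LiebSahi2021, eq. (1.1)] -/
theorem sahiE_one_apply (μ : α → ℝ) (f : Fin 1 → α → ℝ) : sahiE μ 1 f = ex μ (f 0) := rfl

/-- **The Lieb–Sahi recursion** (definitional here): for `n + 2` functions,
`E_{n+2}(f) = Σ_i E_{n+1}(tail f with slot i multiplied by f_0) − E_{n+1}(tail f)·E(f_0)`.
[cite: LiebSahi2021, Prop. 3.3] -/
theorem sahiE_succ_succ (μ : α → ℝ) (n : ℕ) (f : Fin (n + 2) → α → ℝ) :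
    sahiE μ (n + 2) f =
      (∑ i : Fin (n + 1), sahiE μ (n + 1) (Function.update (Fin.tail f) i (Fin.tail f i * f 0))) -
        sahiE μ (n + 1) (Fin.tail f) * ex μ (f 0) := rfl

/-- The recursion in `cons` form: `E_{n+2}(f, g_0,…,g_n) = Σ_i E_{n+1}(g with g_i ↦ g_i·f) − E_{n+1}(g)·E(f)`.
[cite: LiebSahi2021, Prop. 3.3] -/
theorem sahiE_cons (μ : α → ℝ) (n : ℕ) (f : α → ℝ) (g : Fin (n + 1) → α → ℝ) :
    sahiE μ (n + 2) (Matrix.vecCons f g) =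
      (∑ i : Fin (n + 1), sahiE μ (n + 1) (Function.update g i (g i * f))) - sahiE μ (n + 1) g * ex μ f := by
  rw [sahiE_succ_succ]
  rfl

/-! ### Closed forms for `n ≤ 4` (agreement with the printed definition) -/

/-- `E_1(f) = E(f)`. [cite: LiebSahi2021, eq. (1.1)] -/
theorem sahiE_one (μ : α → ℝ) (f : α → ℝ) : sahiE μ 1 ![f] = ex μ f := rfl

/-- `E_2(f,g) = E(fg) − E(f)E(g)`, the covariance (FKG's functional). [cite: LiebSahi2021, eq. (1.1)] -/
theorem sahiE_two (μ : α → ℝ) (f g : α → ℝ) :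
    sahiE μ 2 ![f, g] = ex μ (f * g) - ex μ f * ex μ g := by
  simp only [sahiE, Nat.reduceAdd, univ_unique, Fin.default_eq_zero, Fin.isValue, Fin.tail_vecCons,
    Matrix.cons_val_fin_one, Matrix.cons_val_zero, mul_comm, sum_singleton, Function.update_self]

/-- `E_2` on an arbitrary `Fin 2`-family. [cite: LiebSahi2021, eq. (1.1)] -/
theorem sahiE_two_apply (μ : α → ℝ) (f : Fin 2 → α → ℝ) :
    sahiE μ 2 f = ex μ (f 0 * f 1) - ex μ (f 0) * ex μ (f 1) := by
  have hf : f = ![f 0, f 1] := by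
    ext i x; fin_cases i <;> rfl
  rw [hf, sahiE_two]
  rfl

/-- **`E_3`**: `E_3(f,g,h) = 2E(fgh) + E(f)E(g)E(h) − (E(f)E(gh) + E(g)E(fh) + E(h)E(fg))` — Sahi's
"`E₃ = 2E_(3) − E_(2,1) + E_(1,1,1)`". [cite: Sahi2008, p. 213; LiebSahi2021, eq. (2.1)] -/
theorem sahiE_three (μ : α → ℝ) (f g h : α → ℝ) :
    sahiE μ 3 ![f, g, h] = 2 * ex μ (f * g * h) + ex μ f * ex μ g * ex μ h -
      (ex μ f * ex μ (g * h) + ex μ g * ex μ (f * h) + ex μ h * ex μ (f * g)) := by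
  simp only [sahiE, Nat.reduceAdd, univ_unique, Fin.default_eq_zero, Fin.isValue, Function.update, Fin.tail,
    Matrix.cons_val_succ, Matrix.cons_val_zero, eq_rec_constant, Matrix.cons_val_fin_one, dite_eq_ite,
    Fin.succ_zero_eq_one, Matrix.cons_val_one, mul_ite, ite_mul, Fin.succ_one_eq_two, Matrix.cons_val,
    sum_singleton, reduceIte, sum_sub_distrib, Fin.sum_univ_succ, one_ne_zero, zero_ne_one]
  ring_nf

/-- `E_3` on an arbitrary `Fin 3`-family. [cite: Sahi2008, p. 213; LiebSahi2021, eq. (2.1)] -/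
theorem sahiE_three_apply (μ : α → ℝ) (f : Fin 3 → α → ℝ) :
    sahiE μ 3 f = 2 * ex μ (f 0 * f 1 * f 2) + ex μ (f 0) * ex μ (f 1) * ex μ (f 2) -
      (ex μ (f 0) * ex μ (f 1 * f 2) + ex μ (f 1) * ex μ (f 0 * f 2) + ex μ (f 2) * ex μ (f 0 * f 1)) := by
  have hf : f = ![f 0, f 1, f 2] := by
    ext i x; fin_cases i <;> rfl
  rw [hf, sahiE_three]
  rfl

/-- **`E_4`** (Lieb–Sahi's display, verbatim up to the order of terms):
`E_4 = 6E(f¹f²f³f⁴) − 2[E(f¹)E(f²f³f⁴) + ⋯] + [E(f¹)E(f²)E(f³f⁴) + ⋯] − [E(f¹f²)E(f³f⁴) + ⋯] − E(f¹)E(f²)E(f³)E(f⁴)`.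
[cite: LiebSahi2021, Def. 3.1 (display following it)] -/
theorem sahiE_four (μ : α → ℝ) (a b c d : α → ℝ) :
    sahiE μ 4 ![a, b, c, d] =
      6 * ex μ (a * b * c * d)
      - 2 * (ex μ a * ex μ (b * c * d) + ex μ b * ex μ (a * c * d) + ex μ c * ex μ (a * b * d) +
          ex μ d * ex μ (a * b * c))
      + (ex μ a * ex μ b * ex μ (c * d) + ex μ a * ex μ c * ex μ (b * d) + ex μ a * ex μ d * ex μ (b * c) +
          ex μ b * ex μ c * ex μ (a * d) + ex μ b * ex μ d * ex μ (a * c) + ex μ c * ex μ d * ex μ (a * b))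
      - (ex μ (a * b) * ex μ (c * d) + ex μ (a * c) * ex μ (b * d) + ex μ (a * d) * ex μ (b * c))
      - ex μ a * ex μ b * ex μ c * ex μ d := by
  simp only [sahiE, Nat.reduceAdd, univ_unique, Fin.default_eq_zero, Fin.isValue, Function.update, Fin.tail,
    Matrix.cons_val_succ, Matrix.cons_val_zero, eq_rec_constant, dite_eq_ite, Fin.succ_zero_eq_one,
    Matrix.cons_val_one, mul_ite, ite_mul, Matrix.cons_val_fin_one, Fin.succ_one_eq_two, Matrix.cons_val,
    Fin.reduceSucc, sum_singleton, reduceIte, sum_sub_distrib, Fin.sum_univ_succ, one_ne_zero, zero_ne_one,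
    Fin.reduceEq]
  ring_nf

/-! ### Branching [Sahi2008, Thm. 6] -/

/-- **Branching, head form.** If `f_0 = 1` and `∑ μ = 1` then
`E_{n+2}(1, g_0,…,g_n) = n·E_{n+1}(g_0,…,g_n)` (Sahi: `E_n(f_1,…,f_{n−1},1) = (n−2)E_{n−1}`).
[cite: Sahi2008, Thm. 6 (p. 214); LiebSahi2021, eq. (1.3)] -/
theorem sahiE_succ_succ_of_head_eq_one {μ : α → ℝ} (hμ : ∑ x, μ x = 1) {n : ℕ}
    (f : Fin (n + 2) → α → ℝ) (hf : f 0 = 1) :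
    sahiE μ (n + 2) f = n * sahiE μ (n + 1) (Fin.tail f) := by
  rw [sahiE_succ_succ, hf, ex_one hμ]
  simp only [mul_one, Function.update_eq_self, sum_const, card_univ, Fintype.card_fin, nsmul_eq_mul]
  push_cast
  ring

/-- **Branching, `cons` form**: `E_{n+2}(1, g) = n·E_{n+1}(g)` for a probability weight.
[cite: Sahi2008, Thm. 6 (p. 214); LiebSahi2021, eq. (1.3)] -/
theorem sahiE_one_cons {μ : α → ℝ} (hμ : ∑ x, μ x = 1) (n : ℕ) (g : Fin (n + 1) → α → ℝ) :
    sahiE μ (n + 2) (Matrix.vecCons 1 g) = n * sahiE μ (n + 1) g :=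
  sahiE_succ_succ_of_head_eq_one hμ _ rfl

/-- `E_2(1,1) = 0` under a probability weight. [cite: Sahi2008, Thm. 6 (p. 214)] -/
theorem sahiE_two_one_one {μ : α → ℝ} (hμ : ∑ x, μ x = 1) : sahiE μ 2 ![1, 1] = 0 := by
  rw [sahiE_two, mul_one, ex_one hμ, mul_one, sub_self]

/-- **`E_n(1,…,1) = 0` for `n ≥ 2`** (Richards' third desideratum, part of Sahi's Theorem 6).
[cite: Sahi2008, Thm. 6 (p. 214)] -/
theorem sahiE_const_one {μ : α → ℝ} (hμ : ∑ x, μ x = 1) (n : ℕ) :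
    sahiE μ (n + 2) (fun _ => 1) = 0 := by
  induction n with
  | zero =>
    have h : (fun _ => 1 : Fin 2 → α → ℝ) = ![1, 1] := by
      ext i x; fin_cases i <;> rfl
    rw [h, sahiE_two_one_one hμ]
  | succ n ih =>
    rw [sahiE_succ_succ_of_head_eq_one hμ _ rfl]
    have h : Fin.tail (fun _ => 1 : Fin (n + 3) → α → ℝ) = fun _ => 1 := rfl
    rw [h, ih, mul_zero]

/-! ### Sahi positivity of order `n` (the property; the hierarchy `n + 1 ⇒ n`) -/

/-- **Sahi positivity of order `n`** of a weight `μ` on a finite preorder `α`: `E_n(f_0,…,f_{n−1}) ≥ 0` for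
all pointwise nonnegative monotone `f_0,…,f_{n−1} : α → ℝ` — the `n`-function analogue of positive
association (`n = 2` is exactly the FKG/Harris inequality `E(f)E(g) ≤ E(fg)` for nonnegative monotone pairs,
see `Sahi2008/FKG.lean`).  A PROPERTY of `(α, μ)`, used as a hypothesis; proved here for `n ≤ 1` and every
weight, in `Sahi2008/FKG.lean` for `n = 2` and FKG probability weights (Mathlib's `fkg`).  ("Positive monotone"
= nonnegative and monotone [LiebSahi2021, footnote 2]; the decreasing version is the same property of the
order dual.) [cite: LiebSahi2021, eq. (1.2) and Def. 3.1; Sahi2008, Thm. 2 (p. 211)] -/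
def SahiPositive [Preorder α] (μ : α → ℝ) (n : ℕ) : Prop :=
  ∀ f : Fin n → α → ℝ, (∀ i x, 0 ≤ f i x) → (∀ i, Monotone (f i)) → 0 ≤ sahiE μ n f

/-- Order `0` is vacuous (`E_0 = 0`). [folklore] -/
theorem sahiPositive_zero [Preorder α] (μ : α → ℝ) : SahiPositive μ 0 := by
  intro f _ _
  rw [sahiE_zero]

/-- Order `1`: `E_1(f) = E(f) ≥ 0` for `f ≥ 0` under a nonnegative weight. [cite: LiebSahi2021, eq. (1.2)] -/
theorem sahiPositive_one [Preorder α] {μ : α → ℝ} (hμ : ∀ x, 0 ≤ μ x) : SahiPositive μ 1 := by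
  intro f hf _
  rw [sahiE_one_apply]
  exact ex_nonneg hμ (hf 0)

/-- **The hierarchy: order `n + 1` implies order `n`** for a nonnegative probability weight (from branching,
`E_{n+1}(1, f) = (n − 1)·E_n(f)`; the cases `n ≤ 1` hold outright) — Lieb–Sahi: "if `C_n` denotes the
`n`-function positivity conjecture, then `C_n` implies `C_{n−1}` for `n > 2`".
[cite: LiebSahi2021, p. 3 (after eq. (1.3)); Sahi2008, Thm. 6 (p. 214)] -/
theorem SahiPositive.of_succ [Preorder α] {μ : α → ℝ} (hμ₀ : ∀ x, 0 ≤ μ x) (hμ₁ : ∑ x, μ x = 1) {n : ℕ}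
    (h : SahiPositive μ (n + 1)) : SahiPositive μ n := by
  match n with
  | 0 => exact sahiPositive_zero μ
  | 1 => exact sahiPositive_one hμ₀
  | k + 2 =>
    intro f hf hmono
    have h1 : (0 : ℝ) ≤ sahiE μ (k + 3) (Matrix.vecCons 1 f) := by
      refine h _ (fun i x => ?_) (fun i => ?_)
      · refine Fin.cases ?_ (fun j => ?_) i
        · simp
        · simp [hf j x]
      · refine Fin.cases ?_ (fun j => ?_) i
        · intro x y _
          simp
        · simpa using hmono j
    rw [sahiE_one_cons hμ₁] at h1
    have hk : (0 : ℝ) < (k + 1 : ℕ) := by positivity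
    exact nonneg_of_mul_nonneg_right h1 hk

/-- Order `n` implies every lower order (nonnegative probability weight).
[cite: LiebSahi2021, p. 3 (after eq. (1.3))] -/
theorem SahiPositive.anti [Preorder α] {μ : α → ℝ} (hμ₀ : ∀ x, 0 ≤ μ x) (hμ₁ : ∑ x, μ x = 1) {m n : ℕ}
    (hmn : m ≤ n) (h : SahiPositive μ n) : SahiPositive μ m := by
  induction n, hmn using Nat.le_induction with
  | base => exact h
  | succ k _ ih => exact ih (h.of_succ hμ₀ hμ₁)

end Literature.Combinatorics.Sahi2008
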